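import Summits.ResolutionOfSingularities.ResolutionOfSingularities.Theorems.WildConesCampaignW46ThreefoldsCharTwo

/-!
# [OURS · L1 W4.6, rung (ii) at p = 2] The forced double regime of threefold hypersurfaces in
# characteristic two is INHABITED at every Milnor level: the family `z² = u₀u₁ + u₂^(2j+1)`
# run through the route's point-blow-up dynamics (non-vacuity certificate + calibration of the
# effective bound of `Theorems/WildConesCampaignW46ThreefoldsCharTwo.lean`)

Cell res-hironaka (LADDER-RESOLUTION rung L, D-0089), slot W4.6, seat res-L1-s46-pv-4; host route
`WildCones`, crux `ClassicalRegimes` (stmt-ResolutionOfSingularities-16884). Everything here is OURS and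
about the route's TYPED dynamics (`Theorems/WildConesClassicalRegimesDefs.lean`); NOTHING is a statement
of H. Hironaka's manuscript [Hironaka2017]. AI review is weaker than expert review.

WHY. The rung `threefold_muDrop` / `threefold_not_infRun` / `threefold_exists_exit_le_mu` quantifies over
forced double states (`Isol ∧ MultP`) of `z² = a(u₀,u₁,u₂)`; a refuter's first question is whether that
regime — two CONSECUTIVE forced double states — is inhabited at all for `n = 3`, `p = 2`, and how sharp
the bound «at most `μ(c₀)` consecutive forced double states» is. This file answers by a kernel-checked
run of the dynamics, over EVERY field `κ` of characteristic `2`: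

* states are taken UP TO CLEANING, i.e. through their cleaned series `ser c` (on which `Isol`,
  `MultP`, `OrdP`, `mu` and the successor only depend): `multP_iff_ser`, `exists_ser_eq`;
* for any state `c` with `ser c = X₀X₁ + X₂^(2j+1)`, `j ≥ 1`: `c` is a forced double state, order-2
  cleaned, with `μ(c) = 2j` (`forced_of_ser_eq_pairPow`; Milnor algebra `≅ κ⟦X⟧/(X^(2j))` by the
  tree's hyperbolic-pair descent `MuDropCharTwoOrdP.descent` — `milnor_pairPow`);
* ONE STEP of the dynamics in chart `u₂` with translation `0` maps it to a state with cleaned series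
  `X₀X₁ + X₂^(2j−1)` (`ser_step_of_ser_eq_pairPow`: the dictionary `X₂² · T = a∘Φ` of the crux's
  stub files, the substitution computed, `X₂²` cancelled, the final cleaning shown idle);
* hence the run from such a state along the constant chart word `2`, translations `0`, consists of
  EXACTLY `j` forced double states `X₀X₁ + X₂^(2j+1) ↦ … ↦ X₀X₁ + X₂³` followed by the exit
  `X₀X₁ + X₂` (multiplicity `1`): `ser_run_of_ser_eq_pairPow`, `forcedRun_pairPow`,
  `exit_pairPow`. With `μ = 2j` this shows the bound `forcedPrefix_lt_mu` (`M < μ(c₀)`, here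
  `M = j − 1 < 2j`) is attained up to the factor `2`, and (`exists_forcedDoublePair_threefold`) that the
  hypotheses of `threefold_muDrop` are met — at every Milnor level `2j`, `j ≥ 2`.

References: Greuel–Pfister [GreuelPfister2026] only through the tree's `descent`; folklore otherwise.
-/

noncomputable section

-- single-problem summit: the doubled namespace component `ResolutionOfSingularities` is forced
set_option linter.dupNamespace false

open scoped BigOperators Classical

open MvPowerSeries

open Literature.AlgebraicGeometry.Resolution

namespace Summit.ResolutionOfSingularities.ResolutionOfSingularities.Theorems

namespace CampaignW46.ThreefoldsCharTwo

open WildCones WildCones.MuDropCharTwoOrdP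

variable {κ : Type} [Field κ]

/-! ## States up to cleaning -/

/-- `MultP` read on the cleaned series: multiplicity `p` iff `ser c ≠ 0` and `ord (ser c) ≥ p`.
[folklore] -/
theorem multP_iff_ser {p n : ℕ} (c : (Fin n → ℕ) → κ) :
    MultP p n κ c ↔ ser p n κ c ≠ 0 ∧ (p : ℕ∞) ≤ (ser p n κ c).order := by
  constructor
  · intro hM
    refine ⟨fun h0 => ?_, natCast_le_order_ser hM⟩
    obtain ⟨A, hA⟩ := hM.1
    have h := congrArg (coeff (Finsupp.equivFunOnFinite.symm A)) h0
    rw [coeff_ser, map_zero, Finsupp.coe_equivFunOnFinite_symm] at h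
    exact hA h
  · rintro ⟨h0, hord⟩
    refine ⟨?_, fun A hA => ?_⟩
    · by_contra h
      push Not at h
      apply h0
      ext A
      rw [coeff_ser, map_zero]
      exact h ⇑A
    · have hA' : coeff (Finsupp.equivFunOnFinite.symm A) (ser p n κ c) ≠ 0 := by
        rwa [coeff_ser, Finsupp.coe_equivFunOnFinite_symm]
      have hle := hord.trans (order_le hA')
      rw [Nat.cast_le] at hle
      rw [← Finsupp.coe_equivFunOnFinite_symm A, ← degree_eq_sum_univ]
      exact hle

/-- Every series without monomials `u^A`, `2 ∣ A_j ∀ j` (those the cleaning deletes) is the cleaned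
series of some state — e.g. of its own coefficient function. [folklore] -/
theorem exists_ser_eq {n : ℕ} (f : MvPowerSeries (Fin n) κ)
    (hf : ∀ A : Fin n →₀ ℕ, (∀ j, 2 ∣ A j) → coeff A f = 0) :
    ∃ c : (Fin n → ℕ) → κ, ser 2 n κ c = f := by
  refine ⟨fun A => coeff (Finsupp.equivFunOnFinite.symm A) f, ?_⟩
  ext A
  rw [coeff_ser]
  unfold clean
  by_cases h : ∀ j, 2 ∣ (⇑A) j
  · rw [if_pos h, hf A h]
  · rw [if_neg h]
    change coeff (Finsupp.equivFunOnFinite.symm ⇑A) f = coeff A f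
    rw [Finsupp.equivFunOnFinite_symm_coe]

/-! ## The series `X₀X₁ + X₂^k` in `κ⟦X₀,X₁,X₂⟧` -/

/-- Coefficients of `X₀X₁ + X₂^k`. [folklore] -/
theorem coeff_pairPow (k : ℕ) (A : Fin 3 →₀ ℕ) :
    coeff A ((X 0 * X 1 + X 2 ^ k : MvPowerSeries (Fin 3) κ)) =
      (if A = Finsupp.single 0 1 + Finsupp.single 1 1 then 1 else 0) +
        (if A = Finsupp.single 2 k then 1 else 0) := by
  rw [map_add, X_def, X_def, monomial_mul_monomial, one_mul, X_pow_eq, coeff_monomial, coeff_monomial]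

/-- The square-free quadratic exponent `(1,1,0)` is not a pure power of `X₂`. [folklore] -/
theorem pair_ne_single (k : ℕ) :
    (Finsupp.single 0 1 + Finsupp.single 1 1 : Fin 3 →₀ ℕ) ≠ Finsupp.single 2 k := by
  intro h
  have := DFunLike.congr_fun h 0
  simp at this

/-- `X₀X₁ + X₂^k` has no monomial with all exponents even when `k` is odd (so cleaning fixes it).
[folklore] -/
theorem coeff_pairPow_eq_zero_of_even {k : ℕ} (hk : Odd k) (A : Fin 3 →₀ ℕ) (hA : ∀ j, 2 ∣ A j) :
    coeff A ((X 0 * X 1 + X 2 ^ k : MvPowerSeries (Fin 3) κ)) = 0 := by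
  rw [coeff_pairPow]
  have h1 : A ≠ Finsupp.single 0 1 + Finsupp.single 1 1 := by
    rintro rfl
    have := hA 0
    simp at this
  have h2 : A ≠ Finsupp.single 2 k := by
    rintro rfl
    have h := hA 2
    simp only [Finsupp.single_eq_same] at h
    exact hk.not_two_dvd_nat h
  rw [if_neg h1, if_neg h2, add_zero]

/-- `X₀X₁ + X₂^k ≠ 0`. [folklore] -/
theorem pairPow_ne_zero (k : ℕ) : (X 0 * X 1 + X 2 ^ k : MvPowerSeries (Fin 3) κ) ≠ 0 := by
  intro h
  have := congrArg (coeff (Finsupp.single 0 1 + Finsupp.single 1 1)) h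
  rw [coeff_pairPow, if_pos rfl, if_neg (pair_ne_single k), map_zero] at this
  simp at this

/-- `ord (X₀X₁ + X₂^k) ≥ 2` for `k ≥ 2`. [folklore] -/
theorem two_le_order_pairPow {k : ℕ} (hk : 2 ≤ k) :
    ((2 : ℕ) : ℕ∞) ≤ ((X 0 * X 1 + X 2 ^ k : MvPowerSeries (Fin 3) κ)).order := by
  refine nat_le_order fun d hd => ?_
  rw [coeff_pairPow]
  have h1 : d ≠ Finsupp.single 0 1 + Finsupp.single 1 1 := by
    rintro rfl
    rw [map_add, Finsupp.degree_single, Finsupp.degree_single] at hd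
    omega
  have h2 : d ≠ Finsupp.single 2 k := by
    rintro rfl
    rw [Finsupp.degree_single] at hd
    omega
  rw [if_neg h1, if_neg h2, add_zero]

/-! ## States with cleaned series `X₀X₁ + X₂^k`: multiplicity, order, Milnor number -/

/-- A state with cleaned series `X₀X₁ + X₂^k`, `k ≥ 2`, has multiplicity two. [folklore] -/
theorem multP_of_ser_eq_pairPow {k : ℕ} (hk : 2 ≤ k) {c : (Fin 3 → ℕ) → κ}
    (hc : ser 2 3 κ c = X 0 * X 1 + X 2 ^ k) : MultP 2 3 κ c := by
  rw [multP_iff_ser, hc]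
  exact ⟨pairPow_ne_zero k, two_le_order_pairPow hk⟩

/-- A state with cleaned series `X₀X₁ + X₂` has multiplicity ONE: the dynamics has left the double
regime (the exit of the family's run). [folklore] -/
theorem not_multP_of_ser_eq_pairPow_one {c : (Fin 3 → ℕ) → κ}
    (hc : ser 2 3 κ c = X 0 * X 1 + X 2 ^ 1) : ¬ MultP 2 3 κ c := by
  rw [multP_iff_ser, hc]
  rintro ⟨-, hord⟩
  have hne : coeff (Finsupp.single 2 1) ((X 0 * X 1 + X 2 ^ 1 : MvPowerSeries (Fin 3) κ)) ≠ 0 := by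
    rw [coeff_pairPow, if_neg (pair_ne_single 1).symm, if_pos rfl]
    simp
  have hle := hord.trans (order_le hne)
  rw [Finsupp.degree_single] at hle
  exact absurd hle (by decide)

/-- A state with cleaned series `X₀X₁ + X₂^k` is order-2 cleaned (`OrdP`: the square-free quadratic
monomial `u₀u₁`). [folklore] -/
theorem ordP_of_ser_eq_pairPow {k : ℕ} {c : (Fin 3 → ℕ) → κ}
    (hc : ser 2 3 κ c = X 0 * X 1 + X 2 ^ k) : OrdP 2 3 κ c := by
  refine ⟨⇑(Finsupp.single 0 1 + Finsupp.single 1 1 : Fin 3 →₀ ℕ), ?_, ?_⟩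
  · rw [← coeff_ser, hc, coeff_pairPow, if_pos rfl, if_neg (pair_ne_single k)]
    simp
  · rw [← degree_eq_sum_univ, map_add, Finsupp.degree_single, Finsupp.degree_single]

/-- Partial derivatives of `X₀X₁ + X₂^(m+1)`: `X₁`, `X₀`, `(m+1)·X₂^m`. [folklore] -/
theorem pderiv_pairPow (m : ℕ) (s : Fin 3) :
    MvPowerSeries.pderiv s ((X 0 * X 1 + X 2 ^ (m + 1) : MvPowerSeries (Fin 3) κ)) =
      if s = 0 then X 1 else if s = 1 then X 0
        else ((m + 1 : ℕ) : MvPowerSeries (Fin 3) κ) * X 2 ^ m := by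
  rw [map_add, Derivation.leibniz, Derivation.leibniz_pow, MvPowerSeries.pderiv_X,
    MvPowerSeries.pderiv_X, MvPowerSeries.pderiv_X]
  fin_cases s <;> simp [smul_eq_mul]

/-- The embedding `Fin 1 ↪ Fin 3` onto the index `2` (complement of the hyperbolic pair `{0, 1}`).
[folklore] -/
theorem range_embTwo : ∀ s : Fin 3, s ∈ Set.range (⟨fun _ => (2 : Fin 3),
    fun a b _ => Subsingleton.elim a b⟩ : Fin 1 ↪ Fin 3) ↔ s ≠ 0 ∧ s ≠ 1 := by
  intro s
  fin_cases s <;> simp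

/-- **The Milnor algebra of `X₀X₁ + X₂^(m+1)`** (any field with `m + 1 ≠ 0` in `κ`) is finite of
dimension `m`: the hyperbolic pair `X₀X₁` is killed by the tree's descent
(`MuDropCharTwoOrdP.descent`, here with the identity as reducing automorphism) onto
`κ⟦X⟧/((m+1)X^m) = κ⟦X⟧/(X^m)`. [cite: GreuelPfister2026, Thm 3.5 and Cor 3.7] -/
theorem milnor_pairPow (m : ℕ) (hm : ((m + 1 : ℕ) : κ) ≠ 0) :
    Module.Finite κ (MvPowerSeries (Fin 3) κ ⧸ Ideal.span (Set.range fun s =>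
        MvPowerSeries.pderiv s ((X 0 * X 1 + X 2 ^ (m + 1) : MvPowerSeries (Fin 3) κ)))) ∧
      Module.finrank κ (MvPowerSeries (Fin 3) κ ⧸ Ideal.span (Set.range fun s =>
        MvPowerSeries.pderiv s ((X 0 * X 1 + X 2 ^ (m + 1) : MvPowerSeries (Fin 3) κ)))) = m := by
  set f : MvPowerSeries (Fin 3) κ := X 0 * X 1 + X 2 ^ (m + 1) with hf
  set e : Fin 1 ↪ Fin 3 := ⟨fun _ => (2 : Fin 3), fun a b _ => Subsingleton.elim a b⟩ with he
  have hpd : ∀ s, MvPowerSeries.pderiv s f = if s = 0 then X 1 else if s = 1 then X 0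
      else ((m + 1 : ℕ) : MvPowerSeries (Fin 3) κ) * X 2 ^ m :=
    pderiv_pairPow (κ := κ) m
  set F : MvPowerSeries (Fin 3) κ ≃ₐ[κ] MvPowerSeries (Fin 3) κ := AlgEquiv.refl with hF
  have hsymm : F.symm f = f := rfl
  have hJ : Ideal.span (Set.range fun s => MvPowerSeries.pderiv s f) =
      (Ideal.span (Set.range fun s => MvPowerSeries.pderiv s (F.symm f))).map
        (F : MvPowerSeries (Fin 3) κ →+* MvPowerSeries (Fin 3) κ) := by
    rw [hsymm]
    exact (Ideal.map_id _).symm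
  have hj : (X 1 : MvPowerSeries (Fin 3) κ) ∣ MvPowerSeries.pderiv 0 (F.symm f) := by
    rw [hsymm, hpd]; simp
  have hl : (X 0 : MvPowerSeries (Fin 3) κ) ∣ MvPowerSeries.pderiv 1 (F.symm f) := by
    rw [hsymm, hpd]; simp
  have hXj : (X 0 : MvPowerSeries (Fin 3) κ) ∈
      Ideal.span (Set.range fun s => MvPowerSeries.pderiv s (F.symm f)) := by
    rw [hsymm]
    refine Ideal.subset_span ⟨1, ?_⟩
    simp only [hpd]; simp
  have hXl : (X 1 : MvPowerSeries (Fin 3) κ) ∈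
      Ideal.span (Set.range fun s => MvPowerSeries.pderiv s (F.symm f)) := by
    rw [hsymm]
    refine Ideal.subset_span ⟨0, ?_⟩
    simp only [hpd]; simp
  obtain ⟨ε⟩ := descent (κ := κ) e (j := 0) (l := 1) range_embTwo (f := f) F hJ hj hl hXj hXl
  rw [hsymm] at ε
  -- the one-variable side: `f(0, 0, X) = X^(m+1)`, `∂ X^(m+1) = (m+1) X^m`, a unit multiple of `X^m`
  have hkill : killCompl (R := κ) e f = X 0 ^ (m + 1) := by
    have h2 : (2 : Fin 3) = e 0 := rfl
    rw [hf, map_add, map_mul, map_pow, h2, killCompl_X,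
      killCompl_X_eq_zero (by rw [range_embTwo]; simp), zero_mul, zero_add]
  have hrange : (Set.range fun t : Fin 1 => MvPowerSeries.pderiv t (killCompl (R := κ) e f)) =
      {((m + 1 : ℕ) : MvPowerSeries (Fin 1) κ) * X 0 ^ m} := by
    rw [hkill]
    ext g
    simp only [Set.mem_range, Set.mem_singleton_iff]
    constructor
    · rintro ⟨t, rfl⟩
      fin_cases t
      rw [Derivation.leibniz_pow, MvPowerSeries.pderiv_X]; simp [smul_eq_mul]
    · rintro rfl
      refine ⟨0, ?_⟩
      rw [Derivation.leibniz_pow, MvPowerSeries.pderiv_X]; simp [smul_eq_mul]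
  have hunit : IsUnit (((m + 1 : ℕ) : MvPowerSeries (Fin 1) κ)) := by
    rw [← map_natCast (C (σ := Fin 1) (R := κ))]
    exact (isUnit_iff_ne_zero.mpr hm).map _
  have hI : Ideal.span (Set.range fun t : Fin 1 => MvPowerSeries.pderiv t (killCompl (R := κ) e f)) =
      Ideal.span {(X 0 : MvPowerSeries (Fin 1) κ) ^ m} := by
    rw [hrange, Ideal.span_singleton_mul_left_unit hunit]
  have ε' := ε.trans (Ideal.quotientEquivAlgOfEq κ hI)
  obtain ⟨hfin, hrk⟩ := finrank_quot_X_pow (κ := κ) m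
  haveI := hfin
  exact ⟨Module.Finite.equiv ε'.symm.toLinearEquiv, by rw [ε'.toLinearEquiv.finrank_eq, hrk]⟩

/-- [OURS · L1 W4.6; NOT a statement of the manuscript] **The family's states are forced double
states**: over any field of characteristic `2`, a state of `z² = a(u₀,u₁,u₂)` with cleaned series
`X₀X₁ + X₂^(2j+1)`, `j ≥ 1`, is an isolated double point (`Isol ∧ MultP`), order-2 cleaned, with
Milnor number `μ = 2j`. [folklore] -/
theorem forced_of_ser_eq_pairPow [CharP κ 2] {j : ℕ} (hj : 1 ≤ j) {c : (Fin 3 → ℕ) → κ}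
    (hc : ser 2 3 κ c = X 0 * X 1 + X 2 ^ (2 * j + 1)) :
    Isol 2 3 κ c ∧ MultP 2 3 κ c ∧ OrdP 2 3 κ c ∧ mu 2 3 κ c = 2 * j := by
  have hodd : ((2 * j + 1 : ℕ) : κ) ≠ 0 := by
    rw [Nat.cast_add, Nat.cast_mul, CharP.cast_eq_zero κ 2, zero_mul, zero_add, Nat.cast_one]
    exact one_ne_zero
  obtain ⟨hfin, hrk⟩ := milnor_pairPow (κ := κ) (2 * j) hodd
  refine ⟨?_, multP_of_ser_eq_pairPow (by omega) hc, ordP_of_ser_eq_pairPow hc, ?_⟩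
  · rw [isol_iff_finite_pderiv, hc]
    exact hfin
  · rw [mu_eq_finrank_pderiv, hc, hrk]

/-! ## One step of the dynamics on the family: chart `u₂`, translation `0` -/

/-- The blow-up substitution `Φ_{2,0}` (`X₀ ↦ X₂X₀`, `X₁ ↦ X₂X₁`, `X₂ ↦ X₂`) on `X₀X₁ + X₂^(k+2)`:
`X₂² · (X₀X₁ + X₂^k)`. [folklore] -/
theorem subst_blowFam_pairPow (k : ℕ) :
    subst (fun s => if s = (2 : Fin 3) then (X 2 : MvPowerSeries (Fin 3) κ)
        else X 2 * (X s + C ((0 : Fin 3 → κ) s))) ((X 0 * X 1 + X 2 ^ (k + 2) : MvPowerSeries (Fin 3) κ)) =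
      X 2 ^ 2 * (X 0 * X 1 + X 2 ^ k) := by
  have ha := hasSubst_blowFam (κ := κ) (2 : Fin 3) (0 : Fin 3 → κ)
  rw [subst_add ha, subst_mul ha, subst_pow ha, subst_X ha, subst_X ha, subst_X ha]
  rw [if_neg (show (0 : Fin 3) ≠ 2 by decide), if_neg (show (1 : Fin 3) ≠ 2 by decide), if_pos rfl,
    Pi.zero_apply, Pi.zero_apply, map_zero, add_zero, add_zero]
  ring

/-- [OURS · L1 W4.6; NOT a statement of the manuscript] **One step of the point-blow-up dynamics on
the family**: over any field of characteristic `2`, if `ser c = X₀X₁ + X₂^(k+2)` then the successor of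
`c` in chart `u₂` with translation `0` has cleaned series `X₀X₁ + X₂^k` PROVIDED `k` is odd (for even
`k` the final cleaning would delete `X₂^k`). The crux's dictionary `X₂² · T = (ser c)∘Φ_{2,0}`
(`X_pow_mul_serT_eq_subst`), the substitution computed (`subst_blowFam_pairPow`), `X₂²` cancelled in
the domain `κ⟦X⟧`, and the final cleaning idle on `X₀X₁ + X₂^k` (`coeff_pairPow_eq_zero_of_even`).
[folklore] -/
theorem ser_step_of_ser_eq_pairPow [CharP κ 2] {k : ℕ} (hk : Odd k) {c : (Fin 3 → ℕ) → κ}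
    (hc : ser 2 3 κ c = X 0 * X 1 + X 2 ^ (k + 2)) :
    ser 2 3 κ (step 2 3 κ 2 0 c) = X 0 * X 1 + X 2 ^ k := by
  have hM : MultP 2 3 κ c := multP_of_ser_eq_pairPow (by omega) hc
  have key := X_pow_mul_serT_eq_subst c 2 0 hM
  rw [hc, subst_blowFam_pairPow] at key
  have hX2 : (X 2 : MvPowerSeries (Fin 3) κ) ≠ 0 := fun h => by
    have h1 := congrArg (coeff (Finsupp.single (2 : Fin 3) 1)) h
    rw [coeff_index_single_self_X, map_zero] at h1
    exact one_ne_zero h1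
  have hX : (X 2 : MvPowerSeries (Fin 3) κ) ^ 2 ≠ 0 := pow_ne_zero _ hX2
  have hT := mul_left_cancel₀ hX key
  ext A
  rw [coeff_ser_step c 2 0 hM A]
  have hTA : tr 3 κ 2 0 2 (dv 3 κ 2 2 (bl 3 κ 2 (clean 2 3 κ c))) ⇑A =
      coeff A ((X 0 * X 1 + X 2 ^ k : MvPowerSeries (Fin 3) κ)) := by
    rw [← hT]; rfl
  have clean_apply : ∀ (g : (Fin 3 → ℕ) → κ) (B : Fin 3 → ℕ),
      clean 2 3 κ g B = @ite κ (∀ j, 2 ∣ B j) (Classical.dec _) 0 (g B) := fun _ _ => rfl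
  rw [clean_apply]
  by_cases h : ∀ j, 2 ∣ (⇑A) j
  · rw [if_pos h, coeff_pairPow_eq_zero_of_even hk A h]
  · rw [if_neg h, hTA]

/-! ## The run of the family: exactly `j` forced double states, then the exit -/

/-- [OURS · L1 W4.6; NOT a statement of the manuscript] **The run of the family**: from a state with
cleaned series `X₀X₁ + X₂^(2j+1)` along the constant chart word `2` with translations `0`, the `k`-th
state (`k ≤ j`) has cleaned series `X₀X₁ + X₂^(2(j−k)+1)`. [folklore] -/
theorem ser_run_of_ser_eq_pairPow [CharP κ 2] {j : ℕ} {c : (Fin 3 → ℕ) → κ}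
    (hc : ser 2 3 κ c = X 0 * X 1 + X 2 ^ (2 * j + 1)) :
    ∀ k ≤ j, ser 2 3 κ (run 2 3 κ c (fun _ => 2) (fun _ => 0) k) = X 0 * X 1 + X 2 ^ (2 * (j - k) + 1) := by
  intro k
  induction k with
  | zero => intro _; rw [Nat.sub_zero]; exact hc
  | succ k ih =>
    intro hk
    have h := ih (by omega)
    have heq : 2 * (j - k) + 1 = (2 * (j - (k + 1)) + 1) + 2 := by omega
    rw [heq] at h
    exact ser_step_of_ser_eq_pairPow (by simp) h

/-- [OURS · L1 W4.6; NOT a statement of the manuscript] **Exactly `j` forced double states**: along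
that run the states `0, …, j−1` are isolated double points, order-2 cleaned, with Milnor numbers
`2j, 2j−2, …, 2` — the regime of the rung is inhabited at every Milnor level and `μ` drops by exactly
`2` at each step. [folklore] -/
theorem forcedRun_pairPow [CharP κ 2] {j : ℕ} {c : (Fin 3 → ℕ) → κ}
    (hc : ser 2 3 κ c = X 0 * X 1 + X 2 ^ (2 * j + 1)) :
    ∀ k < j, Isol 2 3 κ (run 2 3 κ c (fun _ => 2) (fun _ => 0) k) ∧
      MultP 2 3 κ (run 2 3 κ c (fun _ => 2) (fun _ => 0) k) ∧
      OrdP 2 3 κ (run 2 3 κ c (fun _ => 2) (fun _ => 0) k) ∧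
      mu 2 3 κ (run 2 3 κ c (fun _ => 2) (fun _ => 0) k) = 2 * (j - k) := fun k hk =>
  forced_of_ser_eq_pairPow (by omega) (ser_run_of_ser_eq_pairPow hc k hk.le)

/-- [OURS · L1 W4.6; NOT a statement of the manuscript] **The exit**: the `j`-th state of that run has
cleaned series `X₀X₁ + X₂`, of multiplicity one — the dynamics has left the double regime (the double
point is resolved there) after exactly `j` forced steps, from Milnor number `μ = 2j`. Compare the
bound `forcedPrefix_lt_mu` (`M < μ(c₀)` consecutive forced states, here `M = j − 1`). [folklore] -/
theorem exit_pairPow [CharP κ 2] {j : ℕ} {c : (Fin 3 → ℕ) → κ}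
    (hc : ser 2 3 κ c = X 0 * X 1 + X 2 ^ (2 * j + 1)) :
    ¬ MultP 2 3 κ (run 2 3 κ c (fun _ => 2) (fun _ => 0) j) := by
  have h := ser_run_of_ser_eq_pairPow hc j le_rfl
  rw [Nat.sub_self, mul_zero, zero_add] at h
  exact not_multP_of_ser_eq_pairPow_one h

/-- [OURS · L1 W4.6; NOT a statement of the manuscript] **Non-vacuity of the rung's one-step shape**:
over EVERY field of characteristic `2` there are a state `c` of `z² = a(u₀,u₁,u₂)`, a chart and a
translation such that `c` AND its successor are isolated double points (with `μ = 4 > 2 = μ'`): the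
hypotheses of `threefold_muDrop` are met. [folklore] -/
theorem exists_forcedDoublePair_threefold (κ : Type) [Field κ] [CharP κ 2] :
    ∃ (c : (Fin 3 → ℕ) → κ) (i : Fin 3) (τ : Fin 3 → κ),
      Isol 2 3 κ c ∧ MultP 2 3 κ c ∧ Isol 2 3 κ (step 2 3 κ i τ c) ∧ MultP 2 3 κ (step 2 3 κ i τ c) ∧
        mu 2 3 κ c = 4 ∧ mu 2 3 κ (step 2 3 κ i τ c) = 2 := by
  obtain ⟨c, hc⟩ := exists_ser_eq (κ := κ) ((X 0 * X 1 + X 2 ^ (2 * 2 + 1) : MvPowerSeries (Fin 3) κ))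
    (coeff_pairPow_eq_zero_of_even (by decide))
  obtain ⟨hI, hM, -, hμ⟩ := forced_of_ser_eq_pairPow (by norm_num) hc
  have hc' : ser 2 3 κ (step 2 3 κ 2 0 c) = X 0 * X 1 + X 2 ^ (2 * 1 + 1) :=
    ser_step_of_ser_eq_pairPow (by decide) hc
  obtain ⟨hI', hM', -, hμ'⟩ := forced_of_ser_eq_pairPow (by norm_num) hc'
  exact ⟨c, 2, 0, hI, hM, hI', hM', hμ, hμ'⟩

end CampaignW46.ThreefoldsCharTwo

end Summit.ResolutionOfSingularities.ResolutionOfSingularities.Theorems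

end
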